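import Mathlib
import HarnessLib
import Summits.HubbardSuperconductivity.HubbardSuperconductivity.Theorems.KLProgrammeKLRegimeVolumeLimitEngineRatesDoor
import Summits.HubbardSuperconductivity.HubbardSuperconductivity.Theorems.KLProgrammeKLRegimeVolumeLimitV14StubVlBound
import Summits.HubbardSuperconductivity.HubbardSuperconductivity.Theses.KLProgramme

/-!
# Child `KLRegimeVolumeLimitV14` (stmt-HubbardSuperconductivity-19921) FROM A VOLUME EXPORT IN THE ENGINE'S OWN FRAME: the route decl
# follows from the same-cutoff two-volume rate of the last-scale two-leg kernel AT THE ADMISSIBLE FRAME `K` of the binders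
# (cell gate-hubbard-kl, seat hubbard-kl-k3c5-p2 g5, technique «analytic-continuation-free assembly via FinalTwoLegVolLimit»; `--supports` the VL child)

The registered open stub `…Theorems.KLRegimeVolumeLimit.stub_vl_carrierRate` of skeleton «cauchy» v3 (d43a8bd19247ce15) asks the engine
lineage for the two-volume rate of the BARE-frame carrier `klSelfEnergy L M β U μ 0 klE0 (nScales β + 1)`.  The engine's objects, however,
live in the frame `K` of the binder prefix (`klPredsV14.frameOK R U (nScales β) μ K`, `TowerP … K …`): its last-scale two-leg kernel is
`klSelfEnergy L M β U μ K klE0 (nScales β + 1)`, and `K = 0` is in general not an admissible frame — so the bare text costs the engine a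
frame transfer `K → 0` on top of the two-volume comparability.  This file removes that cost: the FRAMED text closes the child DIRECTLY,
and with FEWER tree inputs than the bare one (no six-point bound, no density rate):

* `framedCutoffFreeRate_of_framedCarrierRate` — under the child's binders, a same-cutoff framed rate
  `‖Σ̂^K_{L,M}((ω,k),0) − Σ̂^K_{L′,M}((ω,k′),0)‖ ≤ ρ L + D·Σ_i |p_k i − p′_{k′} i|_𝕋` (all `M ≥ M₀(L,L′)`, `L₀ ≤ L ≤ L′`) gives the same
  rate for the cutoff-free carrier `klSelfEnergyInf L β U μ K n ·` at every Matsubara INTEGER `n` (k3c4-p1's `kler_carrierRate_of_sameCutoff`,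
  valid in ANY frame: both finite objects are label-uniformly within `ε` of their `M = ∞` limits, k3c5-p3's `klSelfEnergy_cutoffLimit_labelUniform`);
* **`klRegimeVolumeLimitV14_of_framedCarrierRate (hfr) : …Theses.KLProgramme.KLRegimeVolumeLimitV14`** — `hfr` = the text of
  `stub_vl_carrierRate` with the frame `K` of the binders in place of `0`.  Composition: the bullet above ∘ k3c5-p3's cutoff door
  `stub_vl_twoVolumeRate_of_cutoffFreeRate_V14` (p492329) ∘ the CLOSED framed bound `stub_vl_bound` (k3c4-p2 p495604) ∘ k3c4-p1's Cauchy
  bridge `exists_finalTwoLegVolLimit_of_twoVolumeRate` (p475992).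

So the engine lineage may discharge EITHER text; with the framed one the closer of 19921 is the one-liner
`theorem … : …KLRegimeVolumeLimitV14 := klRegimeVolumeLimitV14_of_framedCarrierRate <framed export>` (`--workitem stmt-HubbardSuperconductivity-19921`).
An implication, sorry-free; it does not itself close the item.  No definitions; nothing is asserted about the model.
-/

noncomputable section

namespace Summit.HubbardSuperconductivity.HubbardSuperconductivity.Theorems.KLRegimeVolumeLimit

set_option linter.dupNamespace false -- summit = problem name (single-conjunct summit), D-0017

open Filter Topology Finset Literature.MathematicalPhysics.QuantumLattice Literature.Probability.LatticeModels GrassmannAlgebra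
open Summit.HubbardSuperconductivity.HubbardSuperconductivity.Theorems.KLProgrammeLegKernels
open Summit.HubbardSuperconductivity.HubbardSuperconductivity.Theorems.KLRegimeSplit
open Summit.HubbardSuperconductivity.HubbardSuperconductivity.Theorems.TwoPointAssembly

/-! ## §1 The framed export text and its cutoff-free form -/

/-- **Framed same-cutoff rate ⇒ cutoff-free framed rate, under the child's binders.**  If, for every datum of the VL child (constant records,
regime point, admissible frame `K`, tower), the last-scale two-leg kernel IN THE FRAME `K` has a same-cutoff two-volume rate with cross-grid
torus modulus beyond a threshold `M₀(L, L′)`, then the cutoff-free carrier `klSelfEnergyInf L β U μ K` has the same rate at every Matsubara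
integer (threshold `max L₀ 3`). -/
theorem framedCutoffFreeRate_of_framedCarrierRate
    (hfr : ∀ (G : GeoConsts) (P : SplitConsts) (Q : EngConsts) (R : RenConsts), G.WF → P.WF → Q.WF → R.WF →
      ∃ c₅ : ℝ, 0 < c₅ ∧ ∀ c : ℝ, 0 < c → c ≤ c₅ → ∃ U₀ : ℝ, 0 < U₀ ∧
        ∀ μ ∈ klWindowC, ∀ U : ℝ, 0 < U → U ≤ U₀ → ∀ β : ℝ, klBetaMin ≤ β → β ≤ Real.exp (c / U ^ 2) →
          ∀ K : TrigPolyC4v, klPredsV14.frameOK R U (nScales β) μ K →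
            ∀ (Lstar : ℕ) (Mstar : ℕ → ℕ), TowerP klPredsV14 G P Q R β U μ K Lstar Mstar →
              ∃ L₀ : ℕ, ∃ D : ℝ, ∃ ρ : ℕ → ℝ, Tendsto ρ atTop (𝓝 0) ∧
                ∀ (L : ℕ) [NeZero L], L₀ ≤ L → ∀ (L' : ℕ) [NeZero L'], L ≤ L' → ∃ M₀ : ℕ, ∀ (M : ℕ) [NeZero M], M₀ ≤ M →
                  ∀ (ω : MatsubaraIdx M) (k : TorusSite 2 L) (k' : TorusSite 2 L'),
                    ‖klSelfEnergy L M β U μ K klE0 (nScales β + 1) (ω, k) 0 -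
                        klSelfEnergy L' M β U μ K klE0 (nScales β + 1) (ω, k') 0‖ ≤
                      ρ L + D * ∑ i, torusAbs (latticeMomentum L k i - latticeMomentum L' k' i)) :
    ∀ (G : GeoConsts) (P : SplitConsts) (Q : EngConsts) (R : RenConsts), G.WF → P.WF → Q.WF → R.WF →
      ∃ c₅ : ℝ, 0 < c₅ ∧ ∀ c : ℝ, 0 < c → c ≤ c₅ → ∃ U₀ : ℝ, 0 < U₀ ∧
        ∀ μ ∈ klWindowC, ∀ U : ℝ, 0 < U → U ≤ U₀ → ∀ β : ℝ, klBetaMin ≤ β → β ≤ Real.exp (c / U ^ 2) →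
          ∀ K : TrigPolyC4v, klPredsV14.frameOK R U (nScales β) μ K →
            ∀ (Lstar : ℕ) (Mstar : ℕ → ℕ), TowerP klPredsV14 G P Q R β U μ K Lstar Mstar →
              ∃ L₀ : ℕ, ∃ D : ℝ, ∃ ρ : ℕ → ℝ, Tendsto ρ atTop (𝓝 0) ∧
                ∀ (L : ℕ) [NeZero L], L₀ ≤ L → ∀ (L' : ℕ) [NeZero L'], L ≤ L' →
                  ∀ (n : ℤ) (k : TorusSite 2 L) (k' : TorusSite 2 L'),
                    ‖klSelfEnergyInf L β U μ K n k - klSelfEnergyInf L' β U μ K n k'‖ ≤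
                      ρ L + D * ∑ i, torusAbs (latticeMomentum L k i - latticeMomentum L' k' i) := by
  intro G P Q R hG hP hQ hR
  obtain ⟨c₅, hc₅, hc⟩ := hfr G P Q R hG hP hQ hR
  refine ⟨c₅, hc₅, fun c hc0 hcc => ?_⟩
  obtain ⟨U₀, hU₀, hU⟩ := hc c hc0 hcc
  refine ⟨U₀, hU₀, fun μ hμ U hU0 hUU β hβmin hβmax K hK Lstar Mstar hT => ?_⟩
  have hβ : 0 < β := KLRegimeSplit.pos_of_klBetaMin_le hβmin
  obtain ⟨L₀, D, ρ, hρ, hS⟩ := hU μ hμ U hU0 hUU β hβmin hβmax K hK Lstar Mstar hT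
  refine ⟨max L₀ 3, D, ρ, hρ, fun L _ hL L' _ hLL' n k k' => ?_⟩
  have hL3 : 3 ≤ L := le_of_max_le_right hL
  obtain ⟨M₀, hM₀⟩ := hS L (le_of_max_le_left hL) L' hLL'
  exact kler_carrierRate_of_sameCutoff hβ U μ K hL3 (hL3.trans hLL') ⟨M₀, fun M _ hM ω _ => hM₀ M hM ω k k'⟩

/-! ## §2 The route decl from the framed export -/

/-- **THE VL CHILD FROM THE FRAMED CARRIER RATE.**  If the last-scale two-leg kernel IN THE ADMISSIBLE FRAME `K` of the binders has a
same-cutoff two-volume rate with cross-grid torus modulus in the KL regime (the text of the registered `stub_vl_carrierRate` with `K` in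
place of the bare frame `0`), then `…Theses.KLProgramme.KLRegimeVolumeLimitV14 = VolumeLimitP2 klPredsV14 FinalTwoLegVolLimitEx klWindowC`
holds: cutoff-free framed rate (§1), finite cutoffs by `stub_vl_twoVolumeRate_of_cutoffFreeRate_V14`, the framed carrier bound by the closed
`stub_vl_bound`, then the Cauchy bridge `exists_finalTwoLegVolLimit_of_twoVolumeRate` (`c₅ := min`, `U₀ := min`, thresholds by `max`).
No six-point bound, no density rate, no frame transfer. -/
theorem klRegimeVolumeLimitV14_of_framedCarrierRate
    (hfr : ∀ (G : GeoConsts) (P : SplitConsts) (Q : EngConsts) (R : RenConsts), G.WF → P.WF → Q.WF → R.WF →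
      ∃ c₅ : ℝ, 0 < c₅ ∧ ∀ c : ℝ, 0 < c → c ≤ c₅ → ∃ U₀ : ℝ, 0 < U₀ ∧
        ∀ μ ∈ klWindowC, ∀ U : ℝ, 0 < U → U ≤ U₀ → ∀ β : ℝ, klBetaMin ≤ β → β ≤ Real.exp (c / U ^ 2) →
          ∀ K : TrigPolyC4v, klPredsV14.frameOK R U (nScales β) μ K →
            ∀ (Lstar : ℕ) (Mstar : ℕ → ℕ), TowerP klPredsV14 G P Q R β U μ K Lstar Mstar →
              ∃ L₀ : ℕ, ∃ D : ℝ, ∃ ρ : ℕ → ℝ, Tendsto ρ atTop (𝓝 0) ∧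
                ∀ (L : ℕ) [NeZero L], L₀ ≤ L → ∀ (L' : ℕ) [NeZero L'], L ≤ L' → ∃ M₀ : ℕ, ∀ (M : ℕ) [NeZero M], M₀ ≤ M →
                  ∀ (ω : MatsubaraIdx M) (k : TorusSite 2 L) (k' : TorusSite 2 L'),
                    ‖klSelfEnergy L M β U μ K klE0 (nScales β + 1) (ω, k) 0 -
                        klSelfEnergy L' M β U μ K klE0 (nScales β + 1) (ω, k') 0‖ ≤
                      ρ L + D * ∑ i, torusAbs (latticeMomentum L k i - latticeMomentum L' k' i)) :
    Summit.HubbardSuperconductivity.HubbardSuperconductivity.Theses.KLProgramme.KLRegimeVolumeLimitV14 := by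
  -- cutoff-free framed rate, then v1's finite-cutoff two-volume rate of the framed carrier
  have htwo := TwoPointAssembly.stub_vl_twoVolumeRate_of_cutoffFreeRate_V14 (framedCutoffFreeRate_of_framedCarrierRate hfr)
  -- composition with the framed carrier bound
  show VolumeLimitP2 klPredsV14 FinalTwoLegVolLimitEx klWindowC
  intro G P Q R hG hP hQ hR
  obtain ⟨c₁, hc₁, h₁⟩ := stub_vl_bound G P Q R hG hP hQ hR
  obtain ⟨c₂, hc₂, h₂⟩ := htwo G P Q R hG hP hQ hR
  refine ⟨min c₁ c₂, lt_min hc₁ hc₂, fun c hc hcle => ?_⟩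
  obtain ⟨U₁, hU₁, h₁'⟩ := h₁ c hc (hcle.trans (min_le_left _ _))
  obtain ⟨U₂, hU₂, h₂'⟩ := h₂ c hc (hcle.trans (min_le_right _ _))
  refine ⟨min U₁ U₂, lt_min hU₁ hU₂, ?_⟩
  intro μ hμ U hU hUle β hβ hβle K hK Lstar Mstar hT
  obtain ⟨B, L₁, Mth₁, hB⟩ := h₁' μ hμ U hU (hUle.trans (min_le_left _ _)) β hβ hβle K hK Lstar Mstar hT
  obtain ⟨L₂, Mth₂, D, ρ, hρ, hrate⟩ := h₂' μ hμ U hU (hUle.trans (min_le_right _ _)) β hβ hβle K hK Lstar Mstar hT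
  refine exists_finalTwoLegVolLimit_of_twoVolumeRate (L₀ := max L₁ L₂) (Mth := fun L => max (Mth₁ L) (Mth₂ L)) (B := B) (D := D) hρ
    (fun L _ hL M _ hM k σ => hB L (le_of_max_le_left hL) M (le_of_max_le_left hM) k σ) ?_
  intro L _ hL M _ hM L' _ hLL' M' _ hM' σ ω ω' hωω' k k'
  exact hrate L (le_of_max_le_right hL) M (le_of_max_le_right hM) L' hLL' M' (le_of_max_le_right hM') σ ω ω' hωω' k k'

end Summit.HubbardSuperconductivity.HubbardSuperconductivity.Theorems.KLRegimeVolumeLimit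

end
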